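import Mathlib
import HarnessLib
import Literature.AlgebraicGeometry.Hassett2000.CubicScrollLoci

/-!
# Cubic `2k`-folds containing a quintic `k`-fold linear section of `G(2,5)`: Hassett's `𝒞₁₄` count and its `k`-fold analogue

B. Hassett, *Special cubic fourfolds*, Compositio Math. 120 (2000) 1–23, §4.1.3 ("d=14: Cubic fourfolds
containing a quartic scroll/Pfaffian cubic fourfolds") [cite: Hassett2000, §4.1.3], verbatim: "One can show
that the quartic scrolls, quintic scrolls, and quintic del Pezzos on `X` generally form families of dimensions
two, two, and five respectively. A dimension count shows that the cubic fourfolds containing any of these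
surfaces forms a divisor `𝒞₁₄ ⊂ 𝒞`. … We should point out another description of an open subset of `𝒞₁₄`: the
Pfaffian cubic fourfolds constructed by Beauville and Donagi [BD]. The dimension counts in the last paragraph
follow from their results."  A quintic del Pezzo surface is a linear section `G(2,5) ∩ ℙ⁵` of the Plücker
Grassmannian `G(2,5) ⊂ ℙ⁹`; its ideal is generated by the five `4 × 4` sub-Pfaffians of a `5 × 5` skew matrix of
linear forms, with the Buchsbaum–Eisenbud resolution `0 → S(−5) → S(−3)⁵ → S(−2)⁵ → S` [folklore].

The fibre-dimension/flag-Hilbert-scheme template is the one of R. Kloosterman, Rend. Sem. Mat. Univ. Padova 148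
(2023), Prop. 3.2 and Thm. 4.14 [cite: Kloosterman2023, Prop. 3.2 and Thm. 4.14] (see the sibling file
`CubicScrollLoci`), here with fibre dimension `5` instead of `2`.

What this file PROVES (arithmetic and two Pfaffian identities; no geometry is formalised, NO fact is
introduced):
* `quinticSectionCubics k = C(k+6,3) − 5(k+4) + 5` — `h⁰(𝒪_Y(3))` for a `k`-dimensional linear section
  `Y = G(2,5) ∩ ℙ^{k+3}` read off the Buchsbaum–Eisenbud resolution in `k + 4` variables
  (`C(k+6,3) − 5·C(k+4,1) + 5·C(k+3,0)`); values `31, 54, 85, 125, 175` (`k = 2,…,6`; `31 = h⁰(−3K)` of the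
  quintic del Pezzo surface) [folklore];
* `quinticSectionFamilyDim k = k² + 12k + 7` — dimension of the family of such `Y ⊂ ℙ^{2k+1}` (span
  `ℙ^{k+3} ⊂ ℙ^{2k+1}`: `(k−2)(k+4)`; the `PGL_{k+4}`-orbit of the section: `10k + 15`); `k = 2`: `35 = dim PGL₆`
  (the quintic del Pezzo surface is projectively rigid with finite automorphism group), `k = 6`: `40 + 99 − 24 =
  115` (`Aut G(2,5) = PGL₅`); a DEFINITION by the closed form (the pub-hlocus census recomputed `35, 52, 71, 92`
  as `𝔤𝔩`-orbit ranks);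
* `quinticLocusCodim k = h⁰(𝒪_Y(3)) − (k² + 12k + 7) + 5` with values `1` (`𝒞₁₄`, Hassett's "five"), `7, 19,
  38, 65` for `k = 3,…,6` — `7, 19, 38` being the codimensions of `T_F V_{[Π₁]+[Π₂]}` measured by the census at
  the Fermat cubic `2k`-fold for two `k`-planes meeting in a `ℙ^{k−3}` (rows C5, E1);
* `planePairPointLocusCodim k = 2C(k+3,3) − C(k,3) − ((k−2)(k+4) + 6(k+1))` (cubic `2k`-folds containing two
  `k`-planes meeting in a `ℙ^{k−3}`; values `2, 8, 20, 39, 66`) and the EXCESS-ONE IDENTITY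
  `planePairPointLocusCodim k − quinticLocusCodim k = 1` for every `k ≥ 2` (`excessQuintic_eq`);
* Pfaffian identities behind "the equation of a cubic containing a quintic section is a `6 × 6` Pfaffian":
  the expansion of the `6 × 6` Pfaffian along its first row equals its expansion along its last column
  (`pf6_eq_expand_last`), hence `Pf(N)` lies in the ideal of the five `4 × 4` Pfaffians of the leading
  `5 × 5` block (`pf6_mem_span_leadingPfaffians`) and in the ideal of those of the trailing block
  (`pf6_mem_span_trailingPfaffians`) — two of the `ℙ⁵ = Gr(5,6)` of quintic cycles lying in one cubic
  `{Pf N = 0}` (the general member is obtained by congruence `N ↦ g N gᵀ`, `Pf ↦ det g · Pf`, not formalised).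

USE (cell pub-hlocus, HOME/pub-hlocus-lit-g4/LIT-ANSWERS-g4.md §G4-F): with the census tangent codimensions `7, 19,
38` and the computed `dim T_Y Hilb(X) = 5` for a cubic `X ⊃ Y` (one implementation), Kloosterman's Thm. 4.14
argument identifies the Hodge-locus component through the Fermat point for `[Π₁]+[Π₂]`, `Π₁ ∩ Π₂ = ℙ^{k−3}`, with
the locus of cubic `2k`-folds having a Pfaffian `ℙ^{k+3}`-section — "`𝒞₁₄` in every even dimension". None of the
measured numbers is vendored as a fact. HONEST FRAMING (cell pub-hlocus): certified instances and evidence bearing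
on the general Hodge conjecture; no claim.
-/

namespace Literature.AlgebraicGeometry.Hassett2000

/-! ## Counts -/

/-- `h⁰(𝒪_Y(3))` for a `k`-dimensional linear section `Y = G(2,5) ∩ ℙ^{k+3}` (codimension-`3` Pfaffian,
Buchsbaum–Eisenbud resolution `0 → S(−5) → S(−3)⁵ → S(−2)⁵ → S` over `k+4` variables):
`C(k+6,3) − 5·(k+4) + 5`. [folklore] -/
def quinticSectionCubics (k : ℕ) : ℤ := ((k + 6).choose 3 : ℤ) - 5 * (k + 4) + 5

/-- `k = 2`: `31 = h⁰(𝒪_{dP₅}(3)) = h⁰(−3K) = 1 + 3·4·5/2`; `k = 3,…,6`: `54, 85, 125, 175` (the census's Hom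
computation returned `31, 54, 85, 125`). [folklore] -/
theorem quinticSectionCubics_table :
    quinticSectionCubics 2 = 31 ∧ quinticSectionCubics 3 = 54 ∧ quinticSectionCubics 4 = 85 ∧
    quinticSectionCubics 5 = 125 ∧ quinticSectionCubics 6 = 175 := by
  decide

/-- `h⁰(−3K) = 1 + 3·(3+1)·5/2 = 31` on the quintic del Pezzo surface (Riemann–Roch), matching `k = 2`.
[folklore] -/
theorem quinticDelPezzo_cubics : (1 + 3 * (3 + 1) * 5 / 2 : ℤ) = quinticSectionCubics 2 := by decide

/-- Dimension of the family of quintic `k`-fold sections `G(2,5) ∩ ℙ^{k+3}` inside `ℙ^{2k+1}`: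
`(k−2)(k+4)` (the span) `+ (10k+15)` (the `PGL_{k+4}`-orbit), `= k² + 12k + 7`; `k = 2`: `35 = dim PGL₆`
(Hassett/Beauville–Donagi), `k = 6`: `40 + (99 − 24) = 115`. A definition by the closed form. [folklore] -/
def quinticSectionFamilyDim (k : ℕ) : ℤ := (k : ℤ) ^ 2 + 12 * k + 7

/-- `k² + 12k + 7 = (k−2)(k+4) + (10k+15)`. [folklore] -/
theorem quinticSectionFamilyDim_eq (k : ℕ) :
    quinticSectionFamilyDim k = ((k : ℤ) - 2) * (k + 4) + (10 * k + 15) := by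
  unfold quinticSectionFamilyDim; ring

/-- `k = 2`: `35 = 6² − 1 = dim PGL₆`; `k = 6`: `115 = 40 + 99 − 24`; in between `52, 71, 92` (census orbit ranks).
[folklore] -/
theorem quinticSectionFamilyDim_table :
    quinticSectionFamilyDim 2 = 6 ^ 2 - 1 ∧ quinticSectionFamilyDim 3 = 52 ∧ quinticSectionFamilyDim 4 = 71 ∧
    quinticSectionFamilyDim 5 = 92 ∧ quinticSectionFamilyDim 6 = 40 + 99 - 24 := by
  decide

/-- Codimension in `ℙ(S₃)` of the locus of cubic `2k`-folds containing a quintic `k`-fold section of `G(2,5)`,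
with five-parameter fibres: `h⁰(𝒪_Y(3)) − dim(family) + 5` (incidence count as in
[cite: Kloosterman2023, Prop. 3.2]; `k = 2` is Hassett's divisor `𝒞₁₄` [cite: Hassett2000, §4.1.3]). -/
def quinticLocusCodim (k : ℕ) : ℤ := quinticSectionCubics k - quinticSectionFamilyDim k + 5

/-- Values `k = 2,…,6 ↦ 1, 7, 19, 38, 65`: `𝒞₁₄` is a divisor (`k = 2`); `7, 19, 38` are the census codimensions of
`T_F V_{[Π₁]+[Π₂]}` for cubic `6`-, `8`-, `10`-folds (planes meeting in `ℙ^{k−3}`); `65` is a prediction for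
cubic `12`-folds. [cite: Hassett2000, §4.1.3] for `k = 2`; the rest is arithmetic. -/
theorem quinticLocusCodim_table :
    quinticLocusCodim 2 = 1 ∧ quinticLocusCodim 3 = 7 ∧ quinticLocusCodim 4 = 19 ∧ quinticLocusCodim 5 = 38 ∧
    quinticLocusCodim 6 = 65 := by
  decide

/-- Closed form: `codim = C(k+6,3) − k² − 17k − 17`. [folklore] -/
theorem quinticLocusCodim_eq (k : ℕ) :
    quinticLocusCodim k = ((k + 6).choose 3 : ℤ) - (k : ℤ) ^ 2 - 17 * k - 17 := by
  unfold quinticLocusCodim quinticSectionCubics quinticSectionFamilyDim; ring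

/-- Codimension, among cubic `2k`-folds, of those containing two `k`-planes meeting in a `ℙ^{k−3}` (`k ≥ 2`):
`h⁰(𝒪_{Π₁∪Π₂}(3)) − dim{pairs} = (2C(k+3,3) − C(k,3)) − ((k−2)(k+4) + 6(k+1))`. `k = 2`: two disjoint planes in
a cubic fourfold, codimension `2` (the degenerate case of `𝒞₁₄` discussed in [cite: Hassett2000, §4.1.3]); `k = 3`:
the census's `codim NL(Π₁,Π₂) = 8` for cubic sixfolds. [folklore] -/
def planePairPointLocusCodim (k : ℕ) : ℤ :=
  2 * ((k + 3).choose 3 : ℤ) - ((k).choose 3 : ℤ) - (((k : ℤ) - 2) * (k + 4) + 6 * (k + 1))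

/-- Values `k = 2,…,6 ↦ 2, 8, 20, 39, 66`. [folklore] -/
theorem planePairPointLocusCodim_table :
    planePairPointLocusCodim 2 = 2 ∧ planePairPointLocusCodim 3 = 8 ∧ planePairPointLocusCodim 4 = 20 ∧
    planePairPointLocusCodim 5 = 39 ∧ planePairPointLocusCodim 6 = 66 := by
  decide

/-- The excess of the quintic-section locus over the pair-of-planes locus it contains. [folklore] -/
def excessQuintic (k : ℕ) : ℤ := planePairPointLocusCodim k - quinticLocusCodim k

/-- `6·C(n+3,3) = (n+3)(n+2)(n+1)`. [folklore] -/
theorem six_mul_choose_three (n : ℕ) : 6 * ((n + 3).choose 3 : ℤ) = (n + 3) * (n + 2) * (n + 1) := by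
  have := Nat.choose_mul_factorial_mul_factorial (show 3 ≤ n + 3 by omega)
  rw [show n + 3 - 3 = n from by omega] at this
  have h : ((n + 3).choose 3) * 6 * n.factorial = (n + 3) * (n + 2) * (n + 1) * n.factorial := by
    have e : (n + 3).factorial = (n + 3) * (n + 2) * (n + 1) * n.factorial := by
      rw [show n + 3 = (n + 2) + 1 from rfl, Nat.factorial_succ, show n + 2 = (n + 1) + 1 from rfl,
        Nat.factorial_succ, Nat.factorial_succ]; ring
    rw [← e, ← this, show (3 : ℕ).factorial = 6 from rfl]
  have hn : n.factorial ≠ 0 := Nat.factorial_ne_zero n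
  have h' := Nat.eq_of_mul_eq_mul_right (Nat.pos_of_ne_zero hn) h
  have h'' : (((n + 3).choose 3 * 6 : ℕ) : ℤ) = (((n + 3) * (n + 2) * (n + 1) : ℕ) : ℤ) := by exact_mod_cast h'
  push_cast at h''
  linarith

/-- EXCESS-ONE IDENTITY: `codim{X ⊃ Π₁ ∪ Π₂, Π₁∩Π₂ = ℙ^{k−3}} − codim{X ⊃ quintic k-fold section} = 1` for every
`k ≥ 2` — the census's observed 'excess `1`' along the whole cubic `λ* = +1` series is the statement
'component = Pfaffian-section locus with five-parameter fibres'. [folklore] -/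
theorem excessQuintic_eq (j : ℕ) : excessQuintic (j + 2) = 1 := by
  rcases j with _ | i
  · decide
  · -- k = i + 3: all three binomials have the closed form `six_mul_choose_three`.
    unfold excessQuintic planePairPointLocusCodim
    rw [quinticLocusCodim_eq]
    have hA := six_mul_choose_three (i + 3)
    rw [show i + 3 + 3 = i + 1 + 2 + 3 from by ring] at hA
    have hB := six_mul_choose_three i
    rw [show i + 3 = i + 1 + 2 from by ring] at hB
    have hC := six_mul_choose_three (i + 6)
    rw [show i + 6 + 3 = i + 1 + 2 + 6 from by ring] at hC
    push_cast at hA hB hC ⊢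
    nlinarith [hA, hB, hC]

/-- Instances `k = 2,…,6`. [folklore] -/
theorem excessQuintic_table :
    excessQuintic 2 = 1 ∧ excessQuintic 3 = 1 ∧ excessQuintic 4 = 1 ∧ excessQuintic 5 = 1 ∧
    excessQuintic 6 = 1 := by
  decide

/-- Predicted dimension of the Hodge locus in moduli (`cubicModuliDim n = C(n+4,3) − (n+2)²`): `19`
(`𝒞₁₄ ⊂ 𝒞`), and `49, 101, 182` = the census's `dim T_F V_δ` for `(n,d,m) = (6,3,0), (8,3,1), (10,3,2)` at
`λ = +1`; `299` predicted for `(12,3,3)`. [folklore] -/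
theorem quinticHodgeLocusDim_table :
    cubicModuliDim 4 - quinticLocusCodim 2 = 19 ∧ cubicModuliDim 6 - quinticLocusCodim 3 = 49 ∧
    cubicModuliDim 8 - quinticLocusCodim 4 = 101 ∧ cubicModuliDim 10 - quinticLocusCodim 5 = 182 ∧
    cubicModuliDim 12 - quinticLocusCodim 6 = 299 := by
  decide

/-! ## Pfaffian identities: `Pf(N)` of a `6 × 6` skew matrix lies in the ideal of the sub-Pfaffians of a
`5 × 5` principal block -/

section Pfaffian

variable {R : Type*} [CommRing R]

/-- The Pfaffian of the `4 × 4` skew matrix with upper entries `(a, b, c ; d, e ; f)` =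
`(x₀₁, x₀₂, x₀₃ ; x₁₂, x₁₃ ; x₂₃)`: `x₀₁x₂₃ − x₀₂x₁₃ + x₀₃x₁₂`. [folklore] -/
def pf4 (a b c d e f : R) : R := a * f - b * e + c * d

/-- The Pfaffian of a `6 × 6` skew matrix with upper-triangular entries `x i j` (`i < j`), DEFINED by expansion
along the first row: `Σ_{j=1}^{5} (−1)^{j+1} x₀ⱼ · Pf(delete 0, j)`. [folklore] -/
def pf6 (x : Fin 6 → Fin 6 → R) : R :=
  x 0 1 * pf4 (x 2 3) (x 2 4) (x 2 5) (x 3 4) (x 3 5) (x 4 5)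
  - x 0 2 * pf4 (x 1 3) (x 1 4) (x 1 5) (x 3 4) (x 3 5) (x 4 5)
  + x 0 3 * pf4 (x 1 2) (x 1 4) (x 1 5) (x 2 4) (x 2 5) (x 4 5)
  - x 0 4 * pf4 (x 1 2) (x 1 3) (x 1 5) (x 2 3) (x 2 5) (x 3 5)
  + x 0 5 * pf4 (x 1 2) (x 1 3) (x 1 4) (x 2 3) (x 2 4) (x 3 4)

/-- The five `4 × 4` sub-Pfaffians of the LEADING `5 × 5` block (indices `0,…,4`; delete `i`). When the entries
are linear forms on `ℙ^{k+3}` these cut out the quintic section `Y`. [folklore] -/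
def leadingPf (x : Fin 6 → Fin 6 → R) : Fin 5 → R
  | ⟨0, _⟩ => pf4 (x 1 2) (x 1 3) (x 1 4) (x 2 3) (x 2 4) (x 3 4)
  | ⟨1, _⟩ => pf4 (x 0 2) (x 0 3) (x 0 4) (x 2 3) (x 2 4) (x 3 4)
  | ⟨2, _⟩ => pf4 (x 0 1) (x 0 3) (x 0 4) (x 1 3) (x 1 4) (x 3 4)
  | ⟨3, _⟩ => pf4 (x 0 1) (x 0 2) (x 0 4) (x 1 2) (x 1 4) (x 2 4)
  | ⟨4, _⟩ => pf4 (x 0 1) (x 0 2) (x 0 3) (x 1 2) (x 1 3) (x 2 3)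

/-- Expansion along the last column: `Pf(N) = Σᵢ (−1)^i x_{i5} · Pf(leading block minus i)`; with
`x_{i5} = ℓᵢ` this is "the cubic `Σ ℓᵢ Pfᵢ` through `Y` is the Pfaffian of the bordered `6 × 6` matrix".
[folklore] -/
theorem pf6_eq_expand_last (x : Fin 6 → Fin 6 → R) :
    pf6 x = x 0 5 * leadingPf x 0 - x 1 5 * leadingPf x 1 + x 2 5 * leadingPf x 2 - x 3 5 * leadingPf x 3
      + x 4 5 * leadingPf x 4 := by
  simp only [pf6, leadingPf, pf4]
  ring

/-- Hence `{Pf N = 0} ⊃ Y`: `Pf(N)` lies in the ideal generated by the five leading sub-Pfaffians. [folklore] -/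
theorem pf6_mem_span_leadingPfaffians (x : Fin 6 → Fin 6 → R) :
    pf6 x ∈ Ideal.span (Set.range (leadingPf x)) := by
  rw [pf6_eq_expand_last]
  have h : ∀ i, leadingPf x i ∈ Ideal.span (Set.range (leadingPf x)) :=
    fun i => Ideal.subset_span ⟨i, rfl⟩
  refine Ideal.add_mem _ (Ideal.sub_mem _ (Ideal.add_mem _ (Ideal.sub_mem _ ?_ ?_) ?_) ?_) ?_
  · exact Ideal.mul_mem_left _ _ (h 0)
  · exact Ideal.mul_mem_left _ _ (h 1)
  · exact Ideal.mul_mem_left _ _ (h 2)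
  · exact Ideal.mul_mem_left _ _ (h 3)
  · exact Ideal.mul_mem_left _ _ (h 4)

/-- The five sub-Pfaffians of the TRAILING `5 × 5` block (indices `1,…,5`; delete `j`): a second quintic cycle
in the same cubic — another point of the `ℙ⁵ = Gr(5,6)` of five-dimensional coordinate subspaces. [folklore] -/
def trailingPf (x : Fin 6 → Fin 6 → R) : Fin 5 → R
  | ⟨0, _⟩ => pf4 (x 2 3) (x 2 4) (x 2 5) (x 3 4) (x 3 5) (x 4 5)
  | ⟨1, _⟩ => pf4 (x 1 3) (x 1 4) (x 1 5) (x 3 4) (x 3 5) (x 4 5)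
  | ⟨2, _⟩ => pf4 (x 1 2) (x 1 4) (x 1 5) (x 2 4) (x 2 5) (x 4 5)
  | ⟨3, _⟩ => pf4 (x 1 2) (x 1 3) (x 1 5) (x 2 3) (x 2 5) (x 3 5)
  | ⟨4, _⟩ => pf4 (x 1 2) (x 1 3) (x 1 4) (x 2 3) (x 2 4) (x 3 4)

/-- `Pf(N)` lies in the ideal of the trailing sub-Pfaffians too (this is the defining expansion). [folklore] -/
theorem pf6_mem_span_trailingPfaffians (x : Fin 6 → Fin 6 → R) :
    pf6 x ∈ Ideal.span (Set.range (trailingPf x)) := by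
  have h : ∀ i, trailingPf x i ∈ Ideal.span (Set.range (trailingPf x)) :=
    fun i => Ideal.subset_span ⟨i, rfl⟩
  have e : pf6 x = x 0 1 * trailingPf x 0 - x 0 2 * trailingPf x 1 + x 0 3 * trailingPf x 2
      - x 0 4 * trailingPf x 3 + x 0 5 * trailingPf x 4 := by
    simp only [pf6, trailingPf]
  rw [e]
  refine Ideal.add_mem _ (Ideal.sub_mem _ (Ideal.add_mem _ (Ideal.sub_mem _ ?_ ?_) ?_) ?_) ?_
  · exact Ideal.mul_mem_left _ _ (h 0)
  · exact Ideal.mul_mem_left _ _ (h 1)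
  · exact Ideal.mul_mem_left _ _ (h 2)
  · exact Ideal.mul_mem_left _ _ (h 3)
  · exact Ideal.mul_mem_left _ _ (h 4)

/-- In particular: at a point where the five leading sub-Pfaffians vanish (a point of `Y`), `Pf(N)` vanishes
(the cubic `{Pf N = 0}` contains `Y`). [folklore] -/
theorem pf6_eq_zero_of_leadingPf_eq_zero (x : Fin 6 → Fin 6 → R) (h : ∀ i, leadingPf x i = 0) :
    pf6 x = 0 := by
  rw [pf6_eq_expand_last, h 0, h 1, h 2, h 3, h 4]; ring

end Pfaffian

end Literature.AlgebraicGeometry.Hassett2000
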